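import Summits.Langlands.Langlands.Theorems.QuadraticWindowHostInducedRepMemberSatakeKlein
import Literature.NumberTheory.Automorphic.BaseChangeInductionAlong

/-!
# Places in a biquadratic tower — helper file 2 (Galois bookkeeping) for stub `stub_asaiPoleInduced`
of line `one-transparent-pane`
(crux `Summit.Langlands.Langlands.Theses.QuadraticWindow.HostInducedRep`, item stmt-Langlands-10902)

LOG (worker `stub_asaiPoleInduced`).  FACT-FREE.  Setting: a tower of number fields `F₀ ⊆ K ⊆ L`
(`IsScalarTower F₀ K L`) with `[L : F₀] = 4`, and two `F₀`-automorphisms `t₀, s₀` of `L` with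
`t₀² = s₀² = 1`, `t₀ ≠ 1`, `s₀ ≠ 1`, `s₀ ≠ t₀`, `s₀ t₀ ≠ 1` (in the stub: `t₀` generates `Gal(L/K)`,
`s₀` is the involution of `L/F'` restricting to the involution `cK` of `K/F₀`).  Proved here:

* `algEquiv_mem_four`, `mul_comm_of_four` — `Gal(L/F₀) = {1, t₀, s₀, s₀t₀}` is the (commutative)
  Klein group (counting: `#Aut ≤ [L:F₀] = 4`); that `L/F₀` is Galois with non-cyclic group, and that
  at a place unramified in a Galois extension with non-cyclic group no place has full residue degree,
  are the landed `paneKlein_isGalois`, `paneKlein_not_isCyclic`, `paneKlein_inertiaDeg_ne_finrank` of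
  the sibling helper file `…MemberSatakeKlein` (originally written for this chain, landed there first;
  LANDING LOG (wave 3): the copies here were deleted, as was `under_smul_of_restricts`, now the landed
  `under_smul_of_comm`; registered anchor `asaiTowerPlaces_anchor` at the end);
* `not_smul_eq_and_smul_eq` — hence above an unramified `v` no place of `L` is fixed by both `t₀` and
  `s₀` (the decomposition group is `1`, `⟨t₀⟩`, `⟨s₀⟩` or `⟨s₀t₀⟩`, never `Gal(L/F₀)`);
* `eq_or_of_under_eq_four` — the places of `L` above `v` are `w, t₀w, s₀w, s₀t₀w`.

Mathlib: `AlgEquiv.card_le`; tree: `HeightOneSpectrum.exists_algEquiv_smul_eq`,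
`finsum_inertiaDeg_eq_finrank`. [folklore]
-/

set_option linter.dupNamespace false -- project-wide option (lakefile weak.linter.dupNamespace); `Summit.Langlands.Langlands` is the mandated namespace

open Literature.NumberTheory.Automorphic
open IsDedekindDomain NumberField

namespace Summit.Langlands.Langlands.Theorems.HostInducedRep.OneTransparentPane

/-! ### The Klein group `{1, t₀, s₀, s₀ t₀}` -/

section Klein

variable {F L : Type} [Field F] [Field L] [Algebra F L]

/-- **`Gal(L/F) = {1, t₀, s₀, s₀t₀}`**: four pairwise distinct automorphisms of an extension of
degree `4` exhaust the automorphism group (`#Aut(L/F) ≤ [L : F]`, Mathlib `AlgEquiv.card_le`).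
[folklore] -/
theorem algEquiv_mem_four (h4 : Module.finrank F L = 4) {t₀ s₀ : L ≃ₐ[F] L} (ht : t₀ ≠ 1)
    (hs : s₀ ≠ 1) (hst : s₀ ≠ t₀) (hst1 : s₀ * t₀ ≠ 1) (g : L ≃ₐ[F] L) :
    g = 1 ∨ g = t₀ ∨ g = s₀ ∨ g = s₀ * t₀ := by
  classical
  haveI : FiniteDimensional F L := Module.finite_of_finrank_eq_succ h4
  have hcard : Fintype.card (L ≃ₐ[F] L) ≤ 4 := h4 ▸ AlgEquiv.card_le
  by_contra h
  simp only [not_or] at h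
  obtain ⟨h₁, h₂, h₃, h₄⟩ := h
  have hst' : s₀ * t₀ ≠ t₀ := fun e => hs (mul_eq_right.mp e)
  have hss' : s₀ * t₀ ≠ s₀ := fun e => ht (mul_eq_left.mp e)
  have h5 : ({1, t₀, s₀, s₀ * t₀, g} : Finset (L ≃ₐ[F] L)).card = 5 := by
    rw [Finset.card_insert_of_notMem, Finset.card_insert_of_notMem, Finset.card_insert_of_notMem,
      Finset.card_insert_of_notMem, Finset.card_singleton]
    · simpa using fun e => h₄ e.symm
    · simp only [Finset.mem_insert, Finset.mem_singleton, not_or]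
      exact ⟨hss'.symm, fun e => h₃ e.symm⟩
    · simp only [Finset.mem_insert, Finset.mem_singleton, not_or]
      exact ⟨hst.symm, hst'.symm, fun e => h₂ e.symm⟩
    · simp only [Finset.mem_insert, Finset.mem_singleton, not_or]
      exact ⟨ht.symm, hs.symm, hst1.symm, fun e => h₁ e.symm⟩
  have := Finset.card_le_univ ({1, t₀, s₀, s₀ * t₀, g} : Finset (L ≃ₐ[F] L))
  omega

/-- The group `{1, t₀, s₀, s₀t₀}` with `t₀² = 1` is commutative: `t₀ s₀ = s₀ t₀` (`t₀ s₀` is one of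
the four and is neither `1`, `t₀` nor `s₀`). [folklore] -/
theorem mul_comm_of_four (h4 : Module.finrank F L = 4) {t₀ s₀ : L ≃ₐ[F] L} (ht : t₀ ≠ 1)
    (hs : s₀ ≠ 1) (hst : s₀ ≠ t₀) (hst1 : s₀ * t₀ ≠ 1) (htt : t₀ * t₀ = 1) :
    t₀ * s₀ = s₀ * t₀ := by
  rcases algEquiv_mem_four h4 ht hs hst hst1 (t₀ * s₀) with h | h | h | h
  · exfalso
    have : s₀ = t₀ := by
      calc s₀ = t₀ * t₀ * s₀ := by rw [htt, one_mul]
        _ = t₀ := by rw [mul_assoc, h, mul_one]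
    exact hst this
  · exact absurd (mul_eq_left.mp h) hs
  · exact absurd (mul_eq_right.mp h) ht
  · exact h

end Klein

/-! ### The biquadratic tower `F₀ ⊆ K ⊆ L` -/

section Tower

open scoped Pointwise

variable {F₀ K L : Type} [Field F₀] [NumberField F₀] [Field K] [NumberField K] [Field L] [NumberField L]
  [Algebra F₀ K] [Algebra K L] [Algebra F₀ L] [IsScalarTower F₀ K L]

/-- The places of `L` above a place `v` of `F₀`, for `Gal(L/F₀) = {1, t₀, s₀, s₀t₀}`: they are
`w, t₀ w, s₀ w, s₀ t₀ w` (transitivity of the Galois group on the fibre,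
`HeightOneSpectrum.exists_algEquiv_smul_eq`). [folklore] -/
theorem eq_or_of_under_eq_four (h4 : Module.finrank F₀ L = 4) {t₀ s₀ : L ≃ₐ[F₀] L} (ht : t₀ ≠ 1)
    (hs : s₀ ≠ 1) (hst : s₀ ≠ t₀) (hst1 : s₀ * t₀ ≠ 1) {w w' : HeightOneSpectrum (𝓞 L)}
    (h : w'.under (𝓞 F₀) = w.under (𝓞 F₀)) :
    w' = w ∨ w' = t₀ • w ∨ w' = s₀ • w ∨ w' = s₀ • t₀ • w := by
  haveI := paneKlein_isGalois h4 ht hs hst hst1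
  obtain ⟨σ, hσ⟩ := HeightOneSpectrum.exists_algEquiv_smul_eq F₀ h.symm
  rcases algEquiv_mem_four h4 ht hs hst hst1 σ with rfl | rfl | rfl | rfl
  · exact Or.inl (by rw [← hσ, one_smul])
  · exact Or.inr (Or.inl hσ.symm)
  · exact Or.inr (Or.inr (Or.inl hσ.symm))
  · exact Or.inr (Or.inr (Or.inr (by rw [← hσ, mul_smul])))

/-- **Above an unramified place no place of `L` is fixed by both `t₀` and `s₀`** (its decomposition
group would be all of the non-cyclic `Gal(L/F₀)`, i.e. `f(w|v) = 4 = [L : F₀]`, excluded by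
`paneKlein_inertiaDeg_ne_finrank`; `f(w|v) = 4` because `w` is then the only place above `v`
and `∑_{w|v} f(w|v) = [L:F₀]` at an unramified `v`, `finsum_inertiaDeg_eq_finrank`). [folklore] -/
theorem not_smul_eq_and_smul_eq (h4 : Module.finrank F₀ L = 4) {t₀ s₀ : L ≃ₐ[F₀] L} (ht : t₀ ≠ 1)
    (hs : s₀ ≠ 1) (hst : s₀ ≠ t₀) (hst1 : s₀ * t₀ ≠ 1) (htt : t₀ * t₀ = 1) (hss : s₀ * s₀ = 1)
    {w : HeightOneSpectrum (𝓞 L)} (hv : Algebra.IsUnramifiedIn (𝓞 L) (w.under (𝓞 F₀)).asIdeal) :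
    ¬ (t₀ • w = w ∧ s₀ • w = w) := by
  rintro ⟨htw, hsw⟩
  haveI := paneKlein_isGalois h4 ht hs hst hst1
  haveI : FiniteDimensional F₀ L := Module.finite_of_finrank_eq_succ h4
  have hG := paneKlein_not_isCyclic ht hs hst htt hss
  refine paneKlein_inertiaDeg_ne_finrank hG (v := w.under (𝓞 F₀)) (W := w) rfl hv ?_
  -- `w` is the only place above `v`, so `f(w|v) = 4`
  have hsum := finsum_inertiaDeg_eq_finrank (E := L) (w.under (𝓞 F₀)) hv
  have hset : {w' : HeightOneSpectrum (𝓞 L) | w'.asIdeal.under (𝓞 F₀) = (w.under (𝓞 F₀)).asIdeal} =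
      {w} := by
    ext w'
    simp only [Set.mem_setOf_eq, Set.mem_singleton_iff]
    constructor
    · intro hw'
      have hu : w'.under (𝓞 F₀) = w.under (𝓞 F₀) :=
        HeightOneSpectrum.ext (by rw [HeightOneSpectrum.under_asIdeal]; exact hw')
      rcases eq_or_of_under_eq_four h4 ht hs hst hst1 hu with h' | h' | h' | h'
      · exact h'
      · rw [h', htw]
      · rw [h', hsw]
      · rw [h', htw, hsw]
    · rintro rfl
      rw [HeightOneSpectrum.under_asIdeal]
  rw [hset, finsum_mem_singleton] at hsum
  exact hsum

end Tower

/-- **Registered anchor** of this helper file (stub registry of stmt-Langlands-10902, line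
`one-transparent-pane`, chain `stub_asaiPoleInduced` 2/7): four pairwise distinct automorphisms of a
degree-`4` extension exhaust its automorphism group, `algEquiv_mem_four`. [folklore] -/
theorem asaiTowerPlaces_anchor : ∀ (F L : Type) [Field F] [Field L] [Algebra F L] (t₀ s₀ g : L ≃ₐ[F] L), Module.finrank F L = 4 → t₀ ≠ 1 → s₀ ≠ 1 → s₀ ≠ t₀ → s₀ * t₀ ≠ 1 → g = 1 ∨ g = t₀ ∨ g = s₀ ∨ g = s₀ * t₀ :=
  fun _ _ _ _ _ _ _ g h4 ht hs hst hst1 => algEquiv_mem_four h4 ht hs hst hst1 g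

end Summit.Langlands.Langlands.Theorems.HostInducedRep.OneTransparentPane
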